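import Mathlib
import HarnessLib
import Summits.Ventures.LatticeQCDFlow.Exactness.IMHKernel
import Summits.Ventures.LatticeQCDFlow.Exactness.NCMCGeneralSpace

/-!
# Path-IMH on a general state space: independence Metropolis over forward evolutions is exact

HONEST FRAMING: exact (Metropolis-corrected) sampling algorithms for lattice gauge theory;
figures of merit are autocorrelation/cost numbers at stated couplings and volumes; no
continuum-physics claim.

Venture `LatticeQCDFlow` (cell pub-lqcd), topic `Exactness`; FANOUT row 13 (`eng-snf`, GEN-9).
NEW WORK of the cell (general measure theory, elementary), not a published result; nothing is
cited as a fact (Crooks 1998/2000; Albergo–Kanwar–Shanahan 2019 "flow-based MCMC";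
Bonanno et al. arXiv:2510.25704 §2 named only).  General-state-space counterpart of the finite
`Exactness/PathIMH.lean` (row 13, GEN-3): the third exact Metropolization of a non-equilibrium
protocol, next to the expanded-ensemble switch (`NCMCGeneralSpaceKernel.lean`) and tempered
transitions (`NCMCGeneralSpaceTempered.lean`), all three from ONE hypothesis, the Crooks pair of
`NCMCGeneralSpace.lean`; the sampler itself is row 30's general independence-Metropolis kernel
`indepMH` (`Exactness/IMHKernel.lean`, `indepMH_invariant`).

## Content (measurable `Ω`, records `E`, a Crooks pair `(κF, κR, s, e, W)` from `ν₀` to `ν₁`)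

* `fwdPathLaw ν₀ κF = (ν₀ Ω)⁻¹ • (ν₀ ∘ κF)` — the normalised law `P_F` of a forward evolution
  started in prior equilibrium (`isProbabilityMeasure_fwdPathLaw` for a finite non-zero prior
  weight and a Markov `κF`);
* `CrooksPair.fwdPathLaw_withDensity` — Crooks, normalised: `e^{-W} · P_F = (ν₀ Ω)⁻¹ • (ν₁ ∘ κR)`;
* `CrooksPair.map_end_bind_rev` — the END-POINT MARGINAL of `ν₁ ∘ κR` is `ν₁` exactly
  (`κR y`-a.s. the record ends at `y`);
* `CrooksPair.lintegral_mul_exp_neg_work`, `CrooksPair.lintegral_exp_neg_work` — Crooks'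
  fluctuation identity for expectations and Jarzynski's identity `E_{P_F}[e^{-W}] = Z₁/Z₀` for ANY
  Crooks pair (the general-state E4 for protocols with layers; `JarzynskiKernel.lean` covers pure
  stochastic protocols by the Feynman–Kac route);
* **`CrooksPair.pathIMH_invariant`** — the independence-Metropolis chain on RECORDS that proposes a
  fresh forward evolution `ω' ∼ P_F` and accepts it against the current one with
  `min 1 (e^{-W(ω')} / e^{-W(ω)})` (path-IMH; the flow-MCMC of Albergo et al. with the work in
  place of `log p/q`) leaves `(ν₀ Ω)⁻¹ • (ν₁ ∘ κR)` invariant — a measure whose end-point marginal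
  is the normalised-by-`Z₀` target weight (`CrooksPair.pathIMH_target_marginal`): reading off the
  end point of the current record samples `ν₁ / Z₁` exactly, for every protocol certified as a
  Crooks pair.
-/

namespace Summit.Ventures.LatticeQCDFlow.Exactness.GeneralNCMC

open MeasureTheory ProbabilityTheory Set
open scoped ENNReal

variable {Ω E : Type*} [MeasurableSpace Ω] [MeasurableSpace E]

/-- The normalised law of a forward evolution started in prior equilibrium:
`P_F = (ν₀ Ω)⁻¹ • (ν₀ ∘ κF)`. -/
noncomputable def fwdPathLaw (ν₀ : Measure Ω) (κF : Kernel Ω E) : Measure E :=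
  (ν₀ univ)⁻¹ • ν₀.bind κF

/-- For a finite, non-zero prior weight and a Markov record kernel, `P_F` is a probability law. -/
theorem isProbabilityMeasure_fwdPathLaw (ν₀ : Measure Ω) [IsFiniteMeasure ν₀] (h0 : ν₀ univ ≠ 0)
    (κF : Kernel Ω E) [IsMarkovKernel κF] : IsProbabilityMeasure (fwdPathLaw ν₀ κF) := by
  refine ⟨?_⟩
  rw [fwdPathLaw, Measure.smul_apply, Measure.bind_apply MeasurableSet.univ (Kernel.aemeasurable _),
    smul_eq_mul]
  simp only [measure_univ, lintegral_const, one_mul]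
  exact ENNReal.inv_mul_cancel h0 (measure_ne_top ν₀ univ)

namespace CrooksPair

variable {ν₀ ν₁ : Measure Ω} {κF κR : Kernel Ω E} {s e : E → Ω} {W : E → ℝ}

/-- **Crooks, normalised**: `e^{-W} · P_F = (ν₀ Ω)⁻¹ • (ν₁ ∘ κR)`. -/
theorem fwdPathLaw_withDensity (h : CrooksPair ν₀ ν₁ κF κR s e W) :
    (fwdPathLaw ν₀ κF).withDensity (fun ε => ENNReal.ofReal (Real.exp (-W ε))) =
      (ν₀ univ)⁻¹ • ν₁.bind κR := by
  rw [fwdPathLaw, withDensity_smul_measure, h.crooks]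

/-- **The end-point marginal of the reverse record law is the target weight**:
`e_* (ν₁ ∘ κR) = ν₁` (records drawn from `κR y` end at `y` a.s.; `κR` Markov). -/
theorem map_end_bind_rev [IsMarkovKernel κR] (h : CrooksPair ν₀ ν₁ κF κR s e W) :
    (ν₁.bind κR).map e = ν₁ := by
  ext B hB
  rw [Measure.map_apply h.measurable_e hB, Measure.bind_apply (h.measurable_e hB) (Kernel.aemeasurable _)]
  have hpt : ∀ y, κR y (e ⁻¹' B) = B.indicator 1 y := fun y => by
    by_cases hy : y ∈ B
    · rw [indicator_of_mem hy, Pi.one_apply, ← measure_univ (μ := κR y)]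
      refine measure_congr ((h.end_ae y).mono fun ε hε => ?_)
      change (ε ∈ e ⁻¹' B) = (ε ∈ univ)
      simp only [mem_preimage, hε, hy, mem_univ]
    · rw [indicator_of_notMem hy]
      refine measure_mono_null (fun ε hε => hε) ?_
      refine (measure_congr ((h.end_ae y).mono fun ε hε => ?_)).trans measure_empty
      change (ε ∈ e ⁻¹' B) = (ε ∈ (∅ : Set E))
      simp only [mem_preimage, hε, hy, mem_empty_iff_false]
  simp_rw [hpt]
  rw [lintegral_indicator_one hB]

/-- **Crooks' fluctuation identity for expectations**: for every measurable `g ≥ 0` on records,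
`∫ g e^{-W} d(ν₀ ∘ κF) = ∫ g d(ν₁ ∘ κR)` — forward averages reweighted by `e^{-W}` are reverse
averages (the identity behind Bennett's acceptance ratio and the crossing of work histograms). -/
theorem lintegral_mul_exp_neg_work (h : CrooksPair ν₀ ν₁ κF κR s e W) {g : E → ℝ≥0∞}
    (hg : Measurable g) :
    ∫⁻ ε, ENNReal.ofReal (Real.exp (-W ε)) * g ε ∂(ν₀.bind κF) = ∫⁻ ε, g ε ∂(ν₁.bind κR) := by
  have hρ : Measurable fun ε => ENNReal.ofReal (Real.exp (-W ε)) :=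
    (Real.measurable_exp.comp h.measurable_W.neg).ennreal_ofReal
  rw [← h.crooks, lintegral_withDensity_eq_lintegral_mul _ hρ hg]
  rfl

/-- **Jarzynski's identity on a general state space, for any Crooks pair** (stochastic steps,
Jacobian-charged layers, concatenations): `∫ e^{-W} d(ν₀ ∘ κF) = ν₁(Ω)`, i.e.
`E_{P_F}[e^{-W}] = Z₁ / Z₀` after dividing by `Z₀ = ν₀(Ω)` (`κR` Markov). -/
theorem lintegral_exp_neg_work [IsMarkovKernel κR] (h : CrooksPair ν₀ ν₁ κF κR s e W) :
    ∫⁻ ε, ENNReal.ofReal (Real.exp (-W ε)) ∂(ν₀.bind κF) = ν₁ univ := by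
  have h1 := h.lintegral_mul_exp_neg_work (g := fun _ => 1) measurable_const
  simp only [mul_one, lintegral_const, one_mul] at h1
  rw [h1, Measure.bind_apply MeasurableSet.univ (Kernel.aemeasurable _)]
  simp only [measure_univ, lintegral_const, one_mul]

/-- **Path-IMH is exact on a general state space.**  The independence-Metropolis kernel on records
with proposal law `P_F` (a fresh forward evolution from prior equilibrium) and weight `e^{-W}`
(`indepMH` of `Exactness/IMHKernel.lean`: accept `ω → ω'` with `min 1 e^{-(W(ω') − W(ω))}`)
leaves `(ν₀ Ω)⁻¹ • (ν₁ ∘ κR)` invariant. -/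
theorem pathIMH_invariant [IsFiniteMeasure ν₀] [IsMarkovKernel κF] (h0 : ν₀ univ ≠ 0)
    (h : CrooksPair ν₀ ν₁ κF κR s e W) :
    haveI := isProbabilityMeasure_fwdPathLaw ν₀ h0 κF
    Kernel.Invariant (indepMH (fwdPathLaw ν₀ κF) fun ε => Real.exp (-W ε))
      ((ν₀ univ)⁻¹ • ν₁.bind κR) := by
  haveI := isProbabilityMeasure_fwdPathLaw ν₀ h0 κF
  rw [← h.fwdPathLaw_withDensity]
  exact indepMH_invariant (Real.measurable_exp.comp h.measurable_W.neg) fun ε => Real.exp_pos _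

/-- **What the end point of the current record samples**: the invariant law's end-point marginal
is `(ν₀ Ω)⁻¹ • ν₁` — the target weight normalised by the PRIOR partition function (total mass
`Z₁/Z₀ = e^{-ΔF}`; as a probability law, `ν₁ / Z₁`). -/
theorem pathIMH_target_marginal [IsMarkovKernel κR] (h : CrooksPair ν₀ ν₁ κF κR s e W) :
    ((ν₀ univ)⁻¹ • ν₁.bind κR).map e = (ν₀ univ)⁻¹ • ν₁ := by
  rw [Measure.map_smul, h.map_end_bind_rev]

end CrooksPair

end Summit.Ventures.LatticeQCDFlow.Exactness.GeneralNCMC
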